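import Mathlib
import HarnessLib
import Literature.Analysis.FluidPDE.ClassicalSolution
import Literature.Analysis.FluidPDE.ClassicalSolutionRescale
import Literature.Analysis.FluidPDE.Vorticity
import Literature.Analysis.FluidPDE.TaoEnstrophyLocalisation
import Literature.Analysis.FluidPDE.TaoCarlemanSlab
import Literature.Analysis.FluidPDE.TaoMainEstimateBackward
import Summits.NavierStokesRegularity.NavierStokesRegularity.Theorems.QuarterLogPincerBeadCensusDefs
import Summits.NavierStokesRegularity.NavierStokesRegularity.Theorems.QuarterLogPincerFlatChainDefs
import Summits.NavierStokesRegularity.NavierStokesRegularity.Theorems.QuarterLogPincerFlatChainTransferGaussian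
import Summits.NavierStokesRegularity.NavierStokesRegularity.Theorems.QuarterLogPincerFlatChainTransferAnnulus
import Summits.NavierStokesRegularity.NavierStokesRegularity.Theorems.QuarterLogPincerFlatChainTransferCube
import Summits.NavierStokesRegularity.NavierStokesRegularity.Theorems.QuarterLogPincerFlatChainTransferDeposit

/-!
# Route `QuarterLogPincer`, crux `TypeIQuantSubcubicExp` (stmt-NavierStokesRegularity-24077), line `flat_chain` —
# S4′ `stub_regularBlockTransfer : RegularBlockTransfer` (the Tao transfer at a regular block), BY NAME

Registered stub S4′ of ns-idea-7 g14's skeleton `Cruxes/TypeIQuantSubcubicExp/Lines/flat_chain.lean`, proved over the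
objects home `Theorems/QuarterLogPincerFlatChainDefs.lean` (`EpochBlock`, `ConcBlock`, `RegularBlock`,
`RegularBlockTransfer`) and the three transfer steps `…FlatChainTransferGaussian` (Tao (5.7)ᵘ in block currency),
`…FlatChainTransferAnnulus` ((5.17)), `…FlatChainTransferCube` ((5.18)), `…FlatChainTransferDeposit` (the scale-free
deposit).

Statement (S4′, verbatim): for every `M, Ce ≥ 1`, `ρ, η > 0`, `Cg ≥ 1` there are a ratio threshold `Λ₁ ≥ 1` and a depth
divisor `D ≥ 8` such that for every `a ≥ 0` there is a deposit `c > 0` with: in the crux frame, at a horizon `t₁ ∈ (0,T]`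
and a level `k+1` of scale `s = t₁e^{-2a(k+1)}` whose trace shell about `x₀` contains a REGULAR BLOCK `(Cg, Λ₁)`, whose
time block `[t₁ − 4s/D, t₁ − s/D]` is an EPOCH BLOCK (`Ce`) and a CONCENTRATION BLOCK (`ρ, η`), the level deposits
`c ≤ ∫_{levelShell} ‖u(t₁)‖³`.

Assembly (`regularBlockTransfer_proof`): translate to the centre (`v := u(·, x₀ + ·)`, `IsClassicalNSSolutionOn.spaceTranslate`);
constants `C₅ = 32(1+‖curlCLM‖)²Cg²` and `Λmin, K` from (5.17), `E = E(Ce,η)` from (5.7), `c₀` from (5.18);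
`D := max (8·10¹²·C₅) (max ρ² 8)` (so that the Gaussian window `[t₁ − σ − σ/(4Ce²), t₁ − σ]`, `σ = s/D`, sits inside Tao's
`ζ`-window `[t₁ − T₅/(4·10¹²), t₁]`, `T₅ = s/C₅`, and `ρ√σ ≤ 400R`); `Λ₁ := max Λmin (8(G+P)/C₅ + 1)`,
`G = 160000·E·D`, `P = Ce²√D/(4η) + 1` (so that `√T₅ e^{−Λ₁R²C₅/(8s)} ≤ ζ₀ = (η√σ/(4Ce²))e^{−E(400R)²/σ}`, the (5.7)
lower bound, for every admissible `R² ≥ 16s`); then (5.17) gives the final-time annular vorticity mass, (5.18) the cube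
mass `c₀η₁₈³r⁶` on a ball `B̄(x₀ + x*, r)`, `4R ≤ |x*| ≤ Λ₁R/4`, `r ≤ 2R`, which lies in the trace shell
`{4M√s < |x − x₀| < eᵃ√s}` (since `4M√s ≤ R` and `Λ₁R ≤ eᵃ√s`), and `…TransferDeposit` bounds `c₀η₁₈³r⁶ ≥ c(…, a)`.

HONEST FRAMING: composition of PROVED tree theorems (Tao 2021 (5.7), (5.17), (5.18)) about HYPOTHETICAL classical solutions;
it closes ONE registered stub (S4′) of a line whose census node (`BeadCensus` / `SliceCensus`) and S1 are OPEN; nothing here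
bears on the truth of ⟨24077⟩, the wall W7 or Navier–Stokes regularity (OPEN / not proved).  pub-ns-dss typer (g39),
`--supports stmt-NavierStokesRegularity-24077`.
-/

set_option linter.dupNamespace false

noncomputable section

open MeasureTheory Set Function Metric Filter Topology
open scoped ENNReal NNReal
open Literature.Analysis Literature.Analysis.FluidPDE
open Summit.NavierStokesRegularity.NavierStokesRegularity.Cruxes.TypeIQuantSubcubicExp.BeadCensus

namespace Summit.NavierStokesRegularity.NavierStokesRegularity.Cruxes.TypeIQuantSubcubicExp.FlatChain

/-! ### The exponential comparison behind the choice of the ratio `Λ₁` -/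

/-- With `Λ₁C₅/8 ≥ G + P`, `P ≥ Ce²√D/(4η)` (`P > 0`), `C₅ ≥ 1` and `q = R²/s ≥ 16` (any real `E`; in use `E > 0`):
`√(s/C₅)·e^{−Λ₁R²C₅/(8s)} ≤ (η√(s/D)/(4Ce²))·e^{−E(400R)²/(s/D)}`, where `G = E·160000·D`. -/
theorem smallness_of_ratio {η Ce D E C₅ Λ₁ P s R : ℝ} (hη : 0 < η) (hCe : 0 < Ce) (hD : 0 < D)
    (hC₅ : 1 ≤ C₅) (hP : Ce ^ 2 * Real.sqrt D / (4 * η) ≤ P) (hP0 : 0 < P)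
    (hΛ : E * 160000 * D + P ≤ Λ₁ * C₅ / 8) (hs : 0 < s) (hq : 16 * s ≤ R ^ 2) :
    Real.sqrt (s / C₅) * Real.exp (-(Λ₁ * R ^ 2 * C₅ / (8 * s))) ≤
      η * Real.sqrt (s / D) / (4 * Ce ^ 2) * Real.exp (-(E * (400 * R) ^ 2 / (s / D))) := by
  have hss : 0 < Real.sqrt s := Real.sqrt_pos.2 hs
  have hsD : 0 < Real.sqrt D := Real.sqrt_pos.2 hD
  have hC₅0 : 0 < C₅ := by linarith
  have hsC₅ : 1 ≤ Real.sqrt C₅ := by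
    rw [show (1 : ℝ) = Real.sqrt 1 from Real.sqrt_one.symm]; exact Real.sqrt_le_sqrt hC₅
  set q : ℝ := R ^ 2 / s with hqdef
  have hq16 : 16 ≤ q := by rw [hqdef, le_div_iff₀ hs]; exact hq
  -- exponents in terms of `q`
  have he1 : Λ₁ * R ^ 2 * C₅ / (8 * s) = Λ₁ * C₅ / 8 * q := by rw [hqdef]; field_simp
  have he2 : E * (400 * R) ^ 2 / (s / D) = E * 160000 * D * q := by rw [hqdef]; field_simp; ring
  rw [he1, he2, Real.sqrt_div hs.le, Real.sqrt_div hs.le]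
  -- `exp(−Λ₁C₅q/8) ≤ exp(−Gq)·exp(−16P)`
  have hexp : Real.exp (-(Λ₁ * C₅ / 8 * q)) ≤ Real.exp (-(E * 160000 * D * q)) * Real.exp (-(16 * P)) := by
    rw [← Real.exp_add]
    refine Real.exp_le_exp.2 ?_
    have h1 : (E * 160000 * D + P) * q ≤ Λ₁ * C₅ / 8 * q :=
      mul_le_mul_of_nonneg_right hΛ (by linarith)
    have h2 : 16 * P ≤ P * q := by nlinarith
    nlinarith
  have h16P : Real.exp (-(16 * P)) ≤ 1 / (16 * P) := by
    have hx : 0 < 16 * P := by positivity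
    rw [Real.exp_neg, inv_eq_one_div]
    exact one_div_le_one_div_of_le hx ((by linarith : 16 * P ≤ 16 * P + 1).trans (Real.add_one_le_exp _))
  -- the prefactors: `(√s/√C₅)/(16P) ≤ η√s/(√D·4Ce²)`
  have hpre : Real.sqrt s / Real.sqrt C₅ * (1 / (16 * P)) ≤ η * (Real.sqrt s / Real.sqrt D) / (4 * Ce ^ 2) := by
    have lhs : Real.sqrt s / Real.sqrt C₅ * (1 / (16 * P)) = Real.sqrt s / (Real.sqrt C₅ * (16 * P)) := by
      rw [div_mul_div_comm, mul_one]
    have rhs : η * (Real.sqrt s / Real.sqrt D) / (4 * Ce ^ 2) = η * Real.sqrt s / (Real.sqrt D * (4 * Ce ^ 2)) := by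
      rw [mul_div_assoc', div_div]
    rw [lhs, rhs, div_le_div_iff₀ (by positivity) (by positivity)]
    -- `√s · (√D·4Ce²) ≤ η√s · (√C₅·16P)`
    have h1 : Real.sqrt D * (4 * Ce ^ 2) ≤ η * (16 * P) := by
      have := mul_le_mul_of_nonneg_left hP (by positivity : (0 : ℝ) ≤ 16 * η)
      have e : 16 * η * (Ce ^ 2 * Real.sqrt D / (4 * η)) = Real.sqrt D * (4 * Ce ^ 2) := by
        field_simp; ring
      linarith [e ▸ this]
    have h2 : η * (16 * P) ≤ η * (Real.sqrt C₅ * (16 * P)) := by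
      refine mul_le_mul_of_nonneg_left ?_ hη.le
      exact le_mul_of_one_le_left (by positivity) hsC₅
    calc Real.sqrt s * (Real.sqrt D * (4 * Ce ^ 2)) ≤ Real.sqrt s * (η * (Real.sqrt C₅ * (16 * P))) :=
          mul_le_mul_of_nonneg_left (h1.trans h2) hss.le
      _ = η * Real.sqrt s * (Real.sqrt C₅ * (16 * P)) := by ring
  calc Real.sqrt s / Real.sqrt C₅ * Real.exp (-(Λ₁ * C₅ / 8 * q))
      ≤ Real.sqrt s / Real.sqrt C₅ * (Real.exp (-(E * 160000 * D * q)) * Real.exp (-(16 * P))) :=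
        mul_le_mul_of_nonneg_left hexp (by positivity)
    _ ≤ Real.sqrt s / Real.sqrt C₅ * (Real.exp (-(E * 160000 * D * q)) * (1 / (16 * P))) :=
        mul_le_mul_of_nonneg_left (mul_le_mul_of_nonneg_left h16P (Real.exp_pos _).le) (by positivity)
    _ = Real.sqrt s / Real.sqrt C₅ * (1 / (16 * P)) * Real.exp (-(E * 160000 * D * q)) := by ring
    _ ≤ η * (Real.sqrt s / Real.sqrt D) / (4 * Ce ^ 2) * Real.exp (-(E * 160000 * D * q)) :=
        mul_le_mul_of_nonneg_right hpre (Real.exp_pos _).le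

/-! ### S4′ -/

/-- **S4′ — the Tao transfer at a regular block** (the statement `RegularBlockTransfer` with its binders displayed;
see the module docstring for the assembly).  [Tao2021QuantitativeNS Thm. 5.1 proof pp. 37–41 (5.7), (5.17), (5.18),
via the tree theorems `vorticity_gaussian_lower_bound_annulus_integral`, `IsClassicalNSSolutionOn.vorticity_annulus_lower_bound`,
`IsClassicalNSSolutionOn.velocity_cube_mass_of_vorticity_mass`; BarkerPrange2021 §3 for the shape] -/
theorem regularBlockTransfer_proof : RegularBlockTransfer := by
  intro M Ce ρ η Cg hM hCe hρ hη hCg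
  -- ### the constants
  obtain ⟨E, hE, hGauss⟩ := blockGaussian_lower_bound Ce η hCe hη
  obtain ⟨Λmin, C₅, K, hΛmin, hC₅, hK, hAnn⟩ := annulus_vorticity_mass Cg hCg
  obtain ⟨c₀, hc₀, hCube⟩ := annulus_cube_mass
  have hCe0 : 0 < Ce := by linarith only [hCe]
  have hC₅0 : 0 < C₅ := by linarith only [hC₅]
  have hκ0 : 0 ≤ ‖curlCLM‖ := norm_nonneg curlCLM
  set D : ℝ := max (8 * 10 ^ 12 * C₅) (max (ρ ^ 2) 8) with hD
  have hD8 : 8 ≤ D := le_trans (le_max_right _ _) (le_max_right _ _)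
  have hD0 : 0 < D := by linarith only [hD8]
  have hDρ : ρ ^ 2 ≤ D := le_trans (le_max_left _ _) (le_max_right _ _)
  have hDC₅ : 8 * 10 ^ 12 * C₅ ≤ D := le_max_left _ _
  set G : ℝ := E * 160000 * D with hG
  have hG0 : 0 ≤ G := by rw [hG]; positivity
  set P : ℝ := Ce ^ 2 * Real.sqrt D / (4 * η) + 1 with hP
  have hP0 : 0 < P := by rw [hP]; positivity
  have hPge : Ce ^ 2 * Real.sqrt D / (4 * η) ≤ P := by rw [hP]; exact le_add_of_nonneg_right zero_le_one
  set Λ₁ : ℝ := max Λmin (8 * (G + P) / C₅ + 1) with hΛ₁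
  have hΛ₁min : Λmin ≤ Λ₁ := le_max_left _ _
  have hΛ₁16 : 16 ≤ Λ₁ := hΛmin.trans hΛ₁min
  have hΛ₁1 : 1 ≤ Λ₁ := by linarith only [hΛ₁16]
  have hΛ₁0 : 0 < Λ₁ := by linarith only [hΛ₁16]
  have hΛ₁GP : G + P ≤ Λ₁ * C₅ / 8 := by
    have h1 : 8 * (G + P) / C₅ + 1 ≤ Λ₁ := le_max_right _ _
    have h2 : 8 * (G + P) / C₅ ≤ Λ₁ := by linarith only [h1]
    rw [div_le_iff₀ hC₅0] at h2
    linarith only [h2]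
  refine ⟨Λ₁, D, hΛ₁1, hD8, fun a ha => ?_⟩
  -- ### the deposit for the separation `a`
  set X : ℝ := Real.exp (2 * a) with hX
  have hX0 : 0 < X := Real.exp_pos _
  obtain ⟨c, hc, hdep⟩ := deposit_lower_bound (η := η) (Ce := Ce) (D := D) (E := E) (C₅ := C₅) (K := K) (Λ₁ := Λ₁)
    (κ := ‖curlCLM‖) (Cg := Cg) (c₀ := c₀) (X := X) hη hCe0 hD0 hE.le hC₅0 (by linarith only [hK]) hΛ₁0 hκ0
    (by linarith only [hCg]) hc₀ hX0
  refine ⟨c, hc, ?_⟩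
  intro T t₁ x₀ u p k hframe ht₁ hblock hepoch hconc
  -- ### the scale of the level and the block radius
  set s : ℝ := levelScale a t₁ (k + 1) with hs
  have hs0 : 0 < s := by rw [hs]; unfold levelScale; exact mul_pos ht₁.1 (Real.exp_pos _)
  have hst₁ : s ≤ t₁ := by
    rw [hs]; unfold levelScale
    have h1 : Real.exp (-2 * a * ↑(k + 1)) ≤ 1 := by
      rw [Real.exp_le_one_iff]
      have : (0 : ℝ) ≤ ↑(k + 1) := Nat.cast_nonneg _
      nlinarith only [ha, this]
    calc t₁ * Real.exp (-2 * a * ↑(k + 1)) ≤ t₁ * 1 := mul_le_mul_of_nonneg_left h1 ht₁.1.le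
      _ = t₁ := mul_one _
  have hss : 0 < Real.sqrt s := Real.sqrt_pos.2 hs0
  obtain ⟨R, hR4, hRΛ, hregR⟩ := hblock
  have hM0 : 0 < M := by linarith
  have hRs : Real.sqrt s ≤ R :=
    (le_mul_of_one_le_left hss.le (by linarith only [hM] : (1 : ℝ) ≤ 4 * M)).trans hR4
  have hR0 : 0 < R := lt_of_lt_of_le hss hRs
  have h16 : 16 * s ≤ R ^ 2 := by
    have h1 : 4 * Real.sqrt s ≤ R :=
      (mul_le_mul_of_nonneg_right (by linarith only [hM] : (4 : ℝ) ≤ 4 * M) hss.le).trans hR4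
    have h2 := pow_le_pow_left₀ (by positivity) h1 2
    rw [mul_pow, Real.sq_sqrt hs0.le] at h2
    linarith only [h2]
  have hXs : R ^ 2 ≤ X * s := by
    have h1 : R ≤ Real.exp a * Real.sqrt s := by
      have : R ≤ Λ₁ * R := le_mul_of_one_le_left hR0.le hΛ₁1
      exact this.trans hRΛ
    have h2 := pow_le_pow_left₀ hR0.le h1 2
    rw [mul_pow, Real.sq_sqrt hs0.le] at h2
    have hX2 : Real.exp a ^ 2 = X := by
      rw [hX, ← Real.exp_nat_mul]; norm_num
    rw [hX2] at h2
    exact h2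
  -- ### the translated solution
  set v : ℝ → EuclideanSpace ℝ (Fin 3) → EuclideanSpace ℝ (Fin 3) := fun t y => u t (x₀ + y) with hv
  set q : ℝ → EuclideanSpace ℝ (Fin 3) → ℝ := fun t y => p t (x₀ + y) with hq
  have hvcl : IsClassicalNSSolutionOn (Icc 0 T) 1 0 v q := by
    have h := hframe.1.spaceTranslate x₀
    have h0 : (fun t (x : EuclideanSpace ℝ (Fin 3)) => (0 : ℝ → EuclideanSpace ℝ (Fin 3) → EuclideanSpace ℝ (Fin 3)) t (x₀ + x))
        = 0 := by funext t x; rfl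
    rw [h0] at h
    exact h
  -- translation identities
  have hfd : ∀ t y, fderiv ℝ (v t) y = fderiv ℝ (u t) (x₀ + y) := fun t y => fderiv_comp_add_left x₀
  have hvort : ∀ t, vorticity v t = fun y => vorticity u t (x₀ + y) := by
    intro t; funext y
    rw [vorticity_apply, vorticity_apply, curl_eq_curlCLM, curl_eq_curlCLM, hv, fderiv_comp_add_left]
  have hvortfd : ∀ t y, fderiv ℝ (vorticity v t) y = fderiv ℝ (vorticity u t) (x₀ + y) := by
    intro t y; rw [hvort t]; exact fderiv_comp_add_left x₀
  have hiter : ∀ t (j : ℕ) y, iteratedFDeriv ℝ j (v t) y = iteratedFDeriv ℝ j (u t) (x₀ + y) :=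
    fun t j y => iteratedFDeriv_comp_add_left j x₀ y
  -- ### (5.7) in block currency on `[t₁ − 4σ, t₁ − σ]`, `σ = s/D`
  set σ : ℝ := s / D with hσ
  have hσ0 : 0 < σ := div_pos hs0 hD0
  have hσs : 8 * σ ≤ s := by
    rw [hσ, show 8 * (s / D) = s * (8 / D) by ring]
    have : 8 / D ≤ 1 := by rw [div_le_one hD0]; exact hD8
    exact mul_le_of_le_one_right hs0.le this
  have hsubG : Icc (t₁ - 4 * σ) (t₁ - σ) ⊆ Icc 0 T :=
    Icc_subset_Icc (by linarith only [hσs, hst₁, hσ0]) (by linarith only [ht₁.2, hσ0])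
  have hvG : IsClassicalNSSolutionOn (Icc (t₁ - 4 * σ) (t₁ - σ)) 1 0 v q :=
    hvcl.mono hsubG (uniqueDiffOn_Icc (by linarith only [hσ0]))
  have hbdv : ∀ t ∈ Icc (t₁ - 4 * σ) (t₁ - σ), ∀ y : EuclideanSpace ℝ (Fin 3),
      ‖v t y‖ ≤ Ce * σ ^ (-(1 / 2 : ℝ)) ∧ ‖fderiv ℝ (v t) y‖ ≤ Ce * σ⁻¹ ∧
        ‖vorticity v t y‖ ≤ Ce * σ⁻¹ ∧ ‖fderiv ℝ (vorticity v t) y‖ ≤ Ce * σ ^ (-(3 / 2 : ℝ)) := by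
    intro t ht y
    obtain ⟨h0, h1, h2, h3⟩ := hepoch t ht (x₀ + y)
    refine ⟨h0, by rw [hfd]; exact h1, by rw [hvort t]; exact h2, by rw [hvortfd]; exact h3⟩
  have hconcv : ∀ t ∈ Icc (t₁ - 4 * σ) (t₁ - σ), η * σ ^ (-(1 / 2 : ℝ)) ≤
      ∫ y in ball (0 : EuclideanSpace ℝ (Fin 3)) (ρ * Real.sqrt σ), ‖vorticity v t y‖ ^ 2 := by
    intro t ht
    have h := hconc t ht
    rw [hvort t, setIntegral_ball_comp_add (fun y => ‖vorticity u t y‖ ^ 2) x₀ 0, add_zero]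
    exact h
  -- the Gaussian radius `R₇ := 400 R`
  have hρσ : ρ * Real.sqrt σ ≤ 400 * R := by
    have hsD : ρ ≤ Real.sqrt D := by
      rw [← Real.sqrt_sq hρ.le]; exact Real.sqrt_le_sqrt hDρ
    have h1 : ρ * Real.sqrt σ ≤ Real.sqrt s := by
      rw [hσ, Real.sqrt_div hs0.le]
      have hsD0 : 0 < Real.sqrt D := Real.sqrt_pos.2 hD0
      rw [mul_div_assoc', div_le_iff₀ hsD0]
      calc ρ * Real.sqrt s ≤ Real.sqrt D * Real.sqrt s := mul_le_mul_of_nonneg_right hsD hss.le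
        _ = Real.sqrt s * Real.sqrt D := mul_comm _ _
    linarith only [h1, hRs, hR0]
  have hσR : σ ≤ (400 * R) ^ 2 := by
    have h1 : σ ≤ s := by linarith only [hσs, hσ0]
    have h2 : (400 * R) ^ 2 = 160000 * R ^ 2 := by ring
    rw [h2]; linarith only [h1, h16, sq_nonneg R]
  have h57 := hGauss hvG hσ0 hρ hbdv hconcv hρσ hσR
  -- ### (5.17) across the regular annulus on `[t₁ − s/32, t₁]`
  have hsubA : Icc (t₁ - s / 32) t₁ ⊆ Icc 0 T := Icc_subset_Icc (by linarith only [hst₁, hs0]) ht₁.2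
  have hvA : IsClassicalNSSolutionOn (Icc (t₁ - s / 32) t₁) 1 0 v q :=
    hvcl.mono hsubA (uniqueDiffOn_Icc (by linarith only [hs0]))
  have hregv : ∀ t ∈ Icc (t₁ - s / 32) t₁, ∀ y : EuclideanSpace ℝ (Fin 3), R < ‖y‖ → ‖y‖ < Λ₁ * R →
      ∀ j : ℕ, j ≤ 2 → ‖iteratedFDeriv ℝ j (v t) y‖ ≤ Cg * s ^ (-(((j : ℝ) + 1) / 2)) := by
    intro t ht y hy1 hy2 j hj
    have h := hregR t ht (x₀ + y) (by rwa [add_sub_cancel_left]) (by rwa [add_sub_cancel_left]) j hj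
    rw [hiter]; exact h
  have hsmall : Real.sqrt (s / C₅) * Real.exp (-(Λ₁ * R ^ 2 * C₅ / (8 * s))) ≤
      η * Real.sqrt (s / D) / (4 * Ce ^ 2) * Real.exp (-(E * (400 * R) ^ 2 / (s / D))) :=
    smallness_of_ratio hη hCe0 hD0 (by linarith only [hC₅]) hPge hP0 (by rw [hG] at hΛ₁GP; exact hΛ₁GP) hs0 h16
  -- the Gaussian window sits inside Tao's `ζ`-window, and the annular enstrophy is continuous in time
  set N : ℝ := (10 : ℝ) ^ 12 with hN
  have hN1 : 1 ≤ N := by rw [hN]; norm_num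
  have hN0 : 0 < N := by linarith only [hN1]
  have hwlen : s / C₅ / N / 4 = s / (4 * N * C₅) := by
    field_simp
  have hwin : t₁ - s / C₅ / N / 4 ≤ t₁ - σ - σ / (4 * Ce ^ 2) := by
    have h1 : σ / (4 * Ce ^ 2) ≤ σ := by
      rw [div_le_iff₀ (by positivity)]
      have hCe2 : (1 : ℝ) ≤ 4 * Ce ^ 2 := by nlinarith only [hCe]
      have : σ * 1 ≤ σ * (4 * Ce ^ 2) := mul_le_mul_of_nonneg_left hCe2 hσ0.le
      linarith only [this]
    have h2 : 2 * σ ≤ s / C₅ / N / 4 := by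
      rw [hwlen]
      calc 2 * σ = 2 * s / D := by rw [hσ]; ring
        _ ≤ 2 * s / (8 * N * C₅) := div_le_div_of_nonneg_left (by positivity) (by positivity) hDC₅
        _ = s / (4 * N * C₅) := by field_simp; ring
    linarith only [h1, h2]
  have hlow : 0 ≤ t₁ - s / C₅ / N / 4 := by
    have h1 : s / (4 * N * C₅) ≤ s := div_le_self hs0.le (by nlinarith only [hN1, hC₅])
    rw [hwlen]; linarith only [h1, hst₁]
  have hlt : t₁ - s / C₅ / N / 4 < t₁ := by
    have : 0 < s / (4 * N * C₅) := by positivity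
    rw [hwlen]; linarith only [this]
  have h57' : η * Real.sqrt (s / D) / (4 * Ce ^ 2) * Real.exp (-(E * (400 * R) ^ 2 / (s / D))) ≤
      ∫ t in (t₁ - s / C₅ / N / 4)..t₁,
        ∫ y in ball (0 : EuclideanSpace ℝ (Fin 3)) (800 * R) \ closedBall 0 (200 * R), ‖vorticity v t y‖ ^ 2 := by
    have e1 : (2 : ℝ) * (400 * R) = 800 * R := by ring
    have e2 : (400 : ℝ) * R / 2 = 200 * R := by ring
    rw [e1, e2] at h57
    refine h57.trans ?_
    -- monotonicity of the time integral of a nonnegative continuous integrand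
    have hA : MeasurableSet (ball (0 : EuclideanSpace ℝ (Fin 3)) (800 * R) \ closedBall 0 (200 * R)) :=
      measurableSet_ball.diff measurableSet_closedBall
    have hsubW : Icc (t₁ - s / C₅ / N / 4) t₁ ⊆ Icc 0 T := Icc_subset_Icc hlow ht₁.2
    have hvW : IsClassicalNSSolutionOn (Icc (t₁ - s / C₅ / N / 4) t₁) 1 0 v q :=
      hvcl.mono hsubW (uniqueDiffOn_Icc hlt)
    have hωc : ContinuousOn (uncurry (vorticity v)) (Icc (t₁ - s / C₅ / N / 4) t₁ ×ˢ univ) :=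
      (hvW.isSmoothSpaceTimeOn_vorticity_Icc hlt).continuousOn
    have hΦ : ContinuousOn (fun z : ℝ × EuclideanSpace ℝ (Fin 3) => ‖vorticity v z.1 z.2‖ ^ 2)
        (Icc (t₁ - s / C₅ / N / 4) t₁ ×ˢ
          closure (ball (0 : EuclideanSpace ℝ (Fin 3)) (800 * R) \ closedBall 0 (200 * R))) :=
      (hωc.norm.pow 2).mono (prod_mono le_rfl (subset_univ _))
    have hcont := TaoCarleman.continuousOn_setIntegral_slice hA (isBounded_ball.subset sdiff_subset) hΦ
    have hσ4 : 0 ≤ σ / (4 * Ce ^ 2) := by positivity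
    refine intervalIntegral.integral_mono_interval hwin (by linarith only [hσ4]) (by linarith only [hσ0]) ?_
      (hcont.intervalIntegrable_of_Icc hlt.le)
    exact Eventually.of_forall fun t => integral_nonneg fun y => sq_nonneg _
  have hmass := hAnn hΛ₁min hs0 hR0 (by linarith only [h16, hs0]) hvA hregv hsmall h57'
  -- ### (5.18)
  have hmpos : 0 < η * Real.sqrt (s / D) / (4 * Ce ^ 2) * Real.exp (-(E * (400 * R) ^ 2 / (s / D))) *
      (C₅ / s) * Real.exp (-(K * Λ₁ ^ 2 * R ^ 2 * C₅ / (4 * s))) := by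
    have : 0 < Real.sqrt (s / D) := Real.sqrt_pos.2 (by positivity)
    positivity
  obtain ⟨xs, hxs1, hxs2, hcube⟩ := hCube hCg hΛ₁16 hs0 hR0 hmpos hvA hregv hmass
  -- ### the scale-free lower bound
  have hdep' := hdep s R hs0 hR0 h16 hXs
  -- ### the ball `B̄(x₀ + x*, r)` lies in the trace shell of the level
  set r : ℝ := min (2 * R) (Real.sqrt (η * Real.sqrt (s / D) / (4 * Ce ^ 2) *
      Real.exp (-(E * (400 * R) ^ 2 / (s / D))) * (C₅ / s) * Real.exp (-(K * Λ₁ ^ 2 * R ^ 2 * C₅ / (4 * s))) /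
        (Λ₁ ^ 3 * R ^ 3)) / (2 * ((‖curlCLM‖ + 1) * Cg * s ^ (-(3 / 2 : ℝ))))) with hr
  have hr2R : r ≤ 2 * R := min_le_left _ _
  have hshell : closedBall (x₀ + xs) r ⊆ levelShell M a t₁ x₀ (k + 1) := by
    intro x hx
    rw [mem_closedBall, dist_eq_norm] at hx
    have hxlow : 2 * R ≤ ‖x - x₀‖ := by
      have h1 : ‖xs‖ ≤ ‖x - x₀‖ + ‖x - (x₀ + xs)‖ := by
        have := norm_sub_le (x - x₀) (x - (x₀ + xs))
        rw [show x - x₀ - (x - (x₀ + xs)) = xs by abel] at this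
        exact this
      linarith only [h1, hx, hxs1, hr2R]
    have hxup : ‖x - x₀‖ < Λ₁ * R := by
      have h1 : ‖x - x₀‖ ≤ ‖x - (x₀ + xs)‖ + ‖xs‖ := by
        have := norm_add_le (x - (x₀ + xs)) xs
        rw [show x - (x₀ + xs) + xs = x - x₀ by abel] at this
        exact this
      have h2 : Λ₁ * R / 4 + 2 * R < Λ₁ * R := by
        have : 16 * R ≤ Λ₁ * R := mul_le_mul_of_nonneg_right hΛ₁16 hR0.le
        linarith only [this, hR0]
      linarith only [h1, h2, hx, hxs2, hr2R]
    refine ⟨?_, ?_⟩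
    · show 4 * M * Real.sqrt (levelScale a t₁ (k + 1)) < ‖x - x₀‖
      rw [← hs]; linarith only [hxlow, hR4, hR0]
    · show ‖x - x₀‖ < Real.exp a * Real.sqrt (levelScale a t₁ (k + 1))
      rw [← hs]; exact lt_of_lt_of_le hxup hRΛ
  -- ### conversion to the `∫⁻`/`‖·‖ₑ` currency of the conclusion
  have ht₁mem : t₁ ∈ Icc 0 T := ⟨ht₁.1.le, ht₁.2⟩
  have hucont : Continuous (u t₁) := (hframe.1.contDiff_velocity ht₁mem).continuous
  have hint : IntegrableOn (fun x => ‖u t₁ x‖ ^ 3) (closedBall (x₀ + xs) r) volume :=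
    ((hucont.norm.pow 3).continuousOn).integrableOn_compact (isCompact_closedBall _ _)
  have htrans : ∫ y in closedBall xs r, ‖v t₁ y‖ ^ 3 = ∫ x in closedBall (x₀ + xs) r, ‖u t₁ x‖ ^ 3 :=
    setIntegral_closedBall_translate (fun x => ‖u t₁ x‖ ^ 3) x₀ xs r
  have hreal : c ≤ ∫ x in closedBall (x₀ + xs) r, ‖u t₁ x‖ ^ 3 := by
    rw [← htrans]; exact hdep'.trans hcube
  calc ENNReal.ofReal c ≤ ENNReal.ofReal (∫ x in closedBall (x₀ + xs) r, ‖u t₁ x‖ ^ 3) :=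
        ENNReal.ofReal_le_ofReal hreal
    _ = ∫⁻ x in closedBall (x₀ + xs) r, ENNReal.ofReal (‖u t₁ x‖ ^ 3) :=
        ofReal_integral_eq_lintegral_ofReal hint (Eventually.of_forall fun x => by positivity)
    _ = ∫⁻ x in closedBall (x₀ + xs) r, ‖u t₁ x‖ₑ ^ (3 : ℝ) := by
        refine lintegral_congr fun x => ?_
        rw [ENNReal.ofReal_pow (norm_nonneg _), ofReal_norm,
          show (3 : ℝ) = ((3 : ℕ) : ℝ) by norm_num, ENNReal.rpow_natCast]
    _ ≤ ∫⁻ x in levelShell M a t₁ x₀ (k + 1), ‖u t₁ x‖ₑ ^ (3 : ℝ) := lintegral_mono_set hshell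

/-- **S4′ `stub_regularBlockTransfer : RegularBlockTransfer`** — the registered stub of LINE `flat_chain`, BY NAME
(`RegularBlockTransfer` = the Defs-home constant, verbatim the line's §7 text). -/
theorem stub_regularBlockTransfer : RegularBlockTransfer := regularBlockTransfer_proof

end Summit.NavierStokesRegularity.NavierStokesRegularity.Cruxes.TypeIQuantSubcubicExp.FlatChain

end
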